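import Summits.AtomisticToContinuum.HydrodynamicLimit.Theorems.ImplosionDichotomyHydroLimitProfilewiseBandKcwfQGlue
import HarnessLib

/-!
# Split certificate — crux `HydroLimitProfilewiseBand` (stmt-AtomisticToContinuum-17372), route ImplosionDichotomy

Crux-strategist `planner-cstrat-stmt-AtomisticToContinuum-17372-s2-0` (gen 1, seat s2), 2026-08-17.
Companion of `STRATEGY-CENSUS.md` v2 §Decomposition D1′ (the FILED decomposition).

WHAT THIS FILE CERTIFIES (kernel-checked, `lean check` rc 0, 0 sorry):
1. The five CHILDREN of the split of `ImplosionDichotomy.HydroLimitProfilewiseBand`, declared here VERBATIM as they are filed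
   (`ledger route edit route-AtomisticToContinuum-ImplosionDichotomy --split HydroLimitProfilewiseBand --into children.json
   --glue-by …hydroLimitProfilewiseBand_of_itemInputs`): bodies = the ledger signatures of the EXISTING items
   stmt-17701 (SEET), stmt-18052 (KCWF-Q), stmt-17691 (LCTF), stmt-17703 (EAT), stmt-13734 (CAT) of route OneFlightGossipEngine,
   so the ledger's signature dedup attaches THIS route to those items (no new item, no new seat): `example : Child ↔ OFGE.Item := Iff.rfl` ×5.
2. The split glue BY NAME: the landed `Theorems.HydroLimitProfilewiseBandKcwfQGlue.hydroLimitProfilewiseBand_of_itemInputs` (p152902,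
   axioms propext / Classical.choice / Quot.sound) has type `C₁ → C₂ → C₃ → C₄ → C₅ → ImplosionDichotomy.HydroLimitProfilewiseBand`
   up to δ-unfolding of the children (`HydroLimitProfilewiseBand_of_subs` below elaborates with the glue as its term), and the same five
   children give the sibling stmt-9133 (`HydroLimitInBand_of_subs`, glue `hydroLimitInBand_of_itemInputs`).
3. Route-file context: the children elaborate under the route file's own header (`import Mathlib / HarnessLib / HarnessLib.Audit /
   Summits.AtomisticToContinuum.Statement` + the two Literature modules the edit adds — `Literature.Analysis.FluidPDE.HardSphereCollisionRecord`
   (`HardSphereFlow.collisionSum`, collision records) and `Literature.MathematicalPhysics.KineticTheory.HardSphereEulerLLN` (`rhoLim`, `profileOf`);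
   checked separately in the strategist's folder as SplitA3.lean, rc 0).
The children are a GENUINE decomposition in the D-0019 sense: none mentions the LLN of the empirical fields at a positive time (none is the
crux reworded; the crux implies none of them; none implies the Statement on its own — two are reference-law LD bounds (KCWF-Q, LCTF),
three are true-law a-priori tail bounds (SEET, EAT, CAT)); the research weight sits in KCWF-Q and LCTF (fixed-packing relaxation in LD
currency — `Literature.Barriers.AtomisticToContinuum.MacroErgodicityBarrier` bites INSIDE them, named not evaded).
-/

noncomputable section

namespace Summit.AtomisticToContinuum.HydrodynamicLimit.Cruxes.HydroLimitProfilewiseBand.SplitCertificate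

open scoped BigOperators Topology Manifold Classical MeasureTheory ProbabilityTheory Matrix InnerProductSpace ComplexConjugate ContinuousMap
open Filter Set Function TopologicalSpace MeasureTheory
open Summit.AtomisticToContinuum.HydrodynamicLimit.Theses

def SuperExponentialEnergyTails : Prop :=
  ∀ (a₀ θ₀ : Literature.MathematicalPhysics.KineticTheory.T3 → ℝ) (u₀ : Literature.MathematicalPhysics.KineticTheory.T3 → Literature.MathematicalPhysics.KineticTheory.V3), Continuous a₀ → Continuous θ₀ → Continuous u₀ → (∀ x, 0 < a₀ x) → (∀ x, 0 < θ₀ x) → ∃ σ₀ : ℝ, 0 < σ₀ ∧ ∀ σ : ℝ, 0 < σ → σ < σ₀ → ∀ (T : ℝ) (ρ θ : ℝ → Literature.MathematicalPhysics.KineticTheory.T3 → ℝ) (u : ℝ → Literature.MathematicalPhysics.KineticTheory.T3 → Literature.MathematicalPhysics.KineticTheory.V3), Literature.MathematicalPhysics.KineticTheory.IsHardSphereEulerSolution σ T ρ u θ → ∀ Φ : (N : ℕ) → Literature.Analysis.FluidPDE.HardSphereFlow (Literature.Analysis.FluidPDE.Torus.geometry (Fin 3)) (Literature.MathematicalPhysics.KineticTheory.hsDiameter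 σ N) (N + 1), Literature.MathematicalPhysics.KineticTheory.TendstoHydroFieldsAt (fun N => Literature.MathematicalPhysics.KineticTheory.localGibbsLaw σ a₀ u₀ θ₀ N (Φ N)) Φ ρ u θ 0 → ∀ t ∈ Set.Ico 0 T, ∀ c : ℝ, 0 < c → ∃ K₀ : ℝ, 0 < K₀ ∧ ∀ K : ℝ, K₀ ≤ K → ∀ ε : ℝ, 0 < ε → ∃ N₀ : ℕ, ∀ N : ℕ, N₀ ≤ N → ∀ s ∈ Set.Icc 0 t, ∫⁻ z, ENNReal.ofReal (((N : ℝ) + 1)⁻¹ * ∑ i : Fin (N + 1), Set.indicator {v : Literature.MathematicalPhysics.KineticTheory.V3 | K < ‖v‖} (fun v => ‖v‖ ^ 3) (((Φ N).flow s z i).2)) ∂(Literature.MathematicalPhysics.KineticTheory.localGibbsLaw σ a₀ u₀ θ₀ N (Φ N)) ≤ ENNReal.ofReal (Real.exp (-(c * K)) + ε)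

def KineticCurrentsLDAlongFamiliesQ : Prop :=
  ∃ η₀ : ℝ, 0 < η₀ ∧ ∀ (t₁ : ℝ) (a θ₀ : ℝ → Literature.MathematicalPhysics.KineticTheory.T3 → ℝ) (u₀ : ℝ → Literature.MathematicalPhysics.KineticTheory.T3 → Literature.MathematicalPhysics.KineticTheory.V3), Continuous (Function.uncurry a) → Continuous (Function.uncurry θ₀) → Continuous (Function.uncurry u₀) → (∀ s x, 0 < a s x) → (∀ s x, 0 < θ₀ s x) → ∀ σ : ℝ, 0 < σ → (∀ s ∈ Set.Icc 0 t₁, σ ^ 3 * (⨆ x, a s x) ≤ η₀ * ∫ x, a s x) → ∀ Φ : (N : ℕ) → Literature.Analysis.FluidPDE.HardSphereFlow (Literature.Analysis.FluidPDE.Torus.geometry (Fin 3)) (Literature.MathematicalPhysics.KineticTheory.hsDiameter σ N) (N + 1), ∃ β₀ : ℝ, 0 < β₀ ∧ ∀ (A : ℝ → Literature.MathematicalPhysics.KineticTheory.T3 → Fin 3 → Fin 3 → ℝ) (b : ℝ → Literature.MathematicalPhysics.KineticTheory.T3 → Literature.MathematicalPhysics.KineticTheory.V3) (G : ℝ → Literature.MathematicalPhysics.KineticTheory.T3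 × ℝ → ℝ), Continuous (Function.uncurry A) → Continuous (Function.uncurry b) → Continuous (Function.uncurry G) → (let F := fun (s : ℝ) (y : Literature.MathematicalPhysics.KineticTheory.T3 × Literature.MathematicalPhysics.KineticTheory.V3) => (∑ j : Fin 3, ∑ k : Fin 3, A s y.1 j k * ((y.2 - u₀ s y.1) j * (y.2 - u₀ s y.1) k)) + (∑ j : Fin 3, b s y.1 j * (y.2 - u₀ s y.1) j) * G s (y.1, ‖y.2 - u₀ s y.1‖ ^ 2); ∀ C : ℝ, 0 < C → (∀ s ∈ Set.Icc 0 t₁, ∀ y : Literature.MathematicalPhysics.KineticTheory.T3 × Literature.MathematicalPhysics.KineticTheory.V3, |F s y| ≤ C * (1 + ‖y.2‖ ^ 2)) → (∀ s ∈ Set.Icc 0 t₁, ∀ x, ∫ v, F s (x, v) * Literature.Analysis.FluidPDE.localMaxwellian 1 (θ₀ s x) (u₀ s x) v = 0) → (∀ s ∈ Set.Icc 0 t₁, ∀ x (j : Fin 3), ∫ v, F s (x, v) * v j * Literature.Analysis.FluidPDE.localMaxwellian 1 (θ₀ s x) (u₀ s x) v = 0) → (∀ s ∈ Set.Icc 0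 t₁, ∀ x, ∫ v, F s (x, v) * ‖v‖ ^ 2 * Literature.Analysis.FluidPDE.localMaxwellian 1 (θ₀ s x) (u₀ s x) v = 0) → ∀ β : ℝ, |β| * C ≤ β₀ → ∀ ε : ℝ, 0 < ε → ∃ τ₀ : ℝ, 0 < τ₀ ∧ ∀ τ : ℝ, τ₀ ≤ τ → ∃ N₀ : ℕ, ∀ N : ℕ, N₀ ≤ N → ∀ s ∈ Set.Icc 0 t₁, ∫⁻ z, ENNReal.ofReal (Real.exp (β * ∑ i : Fin (N + 1), (τ * ((N : ℝ) + 1) ^ (-(1 / 3 : ℝ)))⁻¹ * ∫ r in (0 : ℝ)..(τ * ((N : ℝ) + 1) ^ (-(1 / 3 : ℝ))), F s ((Φ N).flow r z i))) ∂(Literature.MathematicalPhysics.KineticTheory.localGibbsLaw σ (a s) (u₀ s) (θ₀ s) N (Φ N)) ≤ ENNReal.ofReal (Real.exp (ε * ((N : ℝ) + 1))))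

def LocalClampedTransferLDAlongFamilies : Prop :=
  ∃ η₀ : ℝ, 0 < η₀ ∧ ∀ (t₁ : ℝ) (a θ₀ : ℝ → Literature.MathematicalPhysics.KineticTheory.T3 → ℝ) (u₀ : ℝ → Literature.MathematicalPhysics.KineticTheory.T3 → Literature.MathematicalPhysics.KineticTheory.V3) (ha : ∀ s, Continuous (a s)), Continuous (Function.uncurry a) → Continuous (Function.uncurry θ₀) → Continuous (Function.uncurry u₀) → ∀ (ha0 : ∀ s x, 0 < a s x), (∀ s x, 0 < θ₀ s x) → ∀ σ : ℝ, 0 < σ → σ < 1 / 2 → (∀ s ∈ Set.Icc 0 t₁, σ ^ 3 * (⨆ x, a s x) ≤ η₀ * ∫ x, a s x) → ∀ Φ : (N : ℕ) → Literature.Analysis.FluidPDE.HardSphereFlow (Literature.Analysis.FluidPDE.Torus.geometry (Fin 3)) (Literature.MathematicalPhysics.KineticTheory.hsDiameter σ N) (N + 1), ∀ φ : ℝ → Literature.MathematicalPhysics.KineticTheory.T3 → ℝ, Literature.Analysis.FunctionSpaces.Torus.IsSmoothSpaceTimeOn (Set.Icc 0 t₁) φ → ∃ V₀ : ℝ, 0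 < V₀ ∧ ∀ V : ℝ, V₀ ≤ V → ∃ β₀ : ℝ, 0 < β₀ ∧ ∀ β : ℝ, |β| ≤ β₀ → ∀ ε : ℝ, 0 < ε → ∃ τ₀ : ℝ, 0 < τ₀ ∧ ∀ τ : ℝ, τ₀ ≤ τ → ∃ N₀ : ℕ, ∀ N : ℕ, N₀ ≤ N → ∀ s ∈ Set.Icc 0 t₁, (let ρ₀ : Literature.MathematicalPhysics.KineticTheory.T3 → ℝ := Literature.MathematicalPhysics.KineticTheory.rhoLim (Literature.MathematicalPhysics.KineticTheory.profileOf (a s) (ha s) (ha0 s)) σ; let w : ℝ := τ * ((N : ℝ) + 1) ^ (-(1 / 3 : ℝ)); let P := Literature.MathematicalPhysics.KineticTheory.localGibbsLaw σ (a s) (u₀ s) (θ₀ s) N (Φ N); let Z : Literature.MathematicalPhysics.KineticTheory.T3 → ℝ := fun x => Literature.MathematicalPhysics.KineticTheory.hsCompressibility (ρ₀ x * σ ^ 3); let Z' : Literature.MathematicalPhysics.KineticTheory.T3 → ℝ := fun x => deriv Literature.MathematicalPhysics.KineticTheory.hsCompressibility (ρ₀ x * σ ^ 3); let act := fun (i :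 Fin (N + 1)) z => σ / τ * (Φ N).collisionSum (Set.Ioc 0 w) (fun c => if c.fst = i then ‖c.postVel.1 - c.preVel.1‖ + |‖c.postVel.1‖ ^ 2 - ‖c.preVel.1‖ ^ 2| / 2 else 0) z; let ω := fun (i : Fin (N + 1)) z => if act i z ≤ V then (1 : ℝ) else 0; let Xm := fun (k : Fin 3) z => (Φ N).collisionSum (Set.Ioc 0 w) (fun c => ω c.fst z * ω c.snd z * ((φ s c.fstPos - φ s c.sndPos) * (c.postVel.1 k - c.preVel.1 k)) / 2) z; let Am := fun (k : Fin 3) z => (∫ r in (0 : ℝ)..w, ∑ i : Fin (N + 1), Literature.Analysis.FunctionSpaces.Torus.partialDeriv k (φ s) ((Φ N).flow r z i).1 * (θ₀ s ((Φ N).flow r z i).1 * (ρ₀ ((Φ N).flow r z i).1 * σ ^ 3) * Z' ((Φ N).flow r z i).1 + (1 / 3) * (Z ((Φ N).flow r z i).1 - 1) * ‖((Φ N).flow r z i).2 - u₀ s ((Φ N).flow r z i).1‖ ^ 2)) - w * ((N : ℝ) + 1) * ∫ x, ρ₀ x * Literature.Analysis.FunctionSpaces.Torus.partialDeriv k (φ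 s) x * (θ₀ s x * (ρ₀ x * σ ^ 3) * Z' x); let Xe := fun z => (Φ N).collisionSum (Set.Ioc 0 w) (fun c => ω c.fst z * ω c.snd z * ((φ s c.fstPos - φ s c.sndPos) * ((‖c.postVel.1‖ ^ 2 - ‖c.preVel.1‖ ^ 2) / 2)) / 2) z; let Ae := fun z => (∫ r in (0 : ℝ)..w, ∑ i : Fin (N + 1), ((∑ l : Fin 3, u₀ s ((Φ N).flow r z i).1 l * Literature.Analysis.FunctionSpaces.Torus.partialDeriv l (φ s) ((Φ N).flow r z i).1) * (θ₀ s ((Φ N).flow r z i).1 * (ρ₀ ((Φ N).flow r z i).1 * σ ^ 3) * Z' ((Φ N).flow r z i).1 + (1 / 3) * (Z ((Φ N).flow r z i).1 - 1) * ‖((Φ N).flow r z i).2 - u₀ s ((Φ N).flow r z i).1‖ ^ 2) + θ₀ s ((Φ N).flow r z i).1 * (Z ((Φ N).flow r z i).1 - 1) * (∑ l : Fin 3, Literature.Analysis.FunctionSpaces.Torus.partialDeriv l (φ s) ((Φ N).flow r z i).1 * (((Φ N).flow r z i).2 - u₀ s ((Φ N).flow r z i).1) l))) - w * ((N : ℝ)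 + 1) * ∫ x, ρ₀ x * (∑ l : Fin 3, u₀ s x l * Literature.Analysis.FunctionSpaces.Torus.partialDeriv l (φ s) x) * (θ₀ s x * (ρ₀ x * σ ^ 3) * Z' x); (∀ k : Fin 3, ∫⁻ z, ENNReal.ofReal (Real.exp (β * (w⁻¹ * Xm k z - w⁻¹ * Am k z))) ∂P ≤ ENNReal.ofReal (Real.exp (ε * ((N : ℝ) + 1)))) ∧ ∫⁻ z, ENNReal.ofReal (Real.exp (β * (w⁻¹ * Xe z - w⁻¹ * Ae z))) ∂P ≤ ENNReal.ofReal (Real.exp (ε * ((N : ℝ) + 1))))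

def EnergyActivityTails : Prop :=
  ∀ (a₀ θ₀ : Literature.MathematicalPhysics.KineticTheory.T3 → ℝ) (u₀ : Literature.MathematicalPhysics.KineticTheory.T3 → Literature.MathematicalPhysics.KineticTheory.V3), Continuous a₀ → Continuous θ₀ → Continuous u₀ → (∀ x, 0 < a₀ x) → (∀ x, 0 < θ₀ x) → ∃ σ₀ : ℝ, 0 < σ₀ ∧ ∀ σ : ℝ, 0 < σ → σ < σ₀ → ∀ (T : ℝ) (ρ θ : ℝ → Literature.MathematicalPhysics.KineticTheory.T3 → ℝ) (u : ℝ → Literature.MathematicalPhysics.KineticTheory.T3 → Literature.MathematicalPhysics.KineticTheory.V3), Literature.MathematicalPhysics.KineticTheory.IsHardSphereEulerSolution σ T ρ u θ → ∀ Φ : (N : ℕ) → Literature.Analysis.FluidPDE.HardSphereFlow (Literature.Analysis.FluidPDE.Torus.geometry (Fin 3)) (Literature.MathematicalPhysics.KineticTheory.hsDiameter σ N) (N + 1), Literature.MathematicalPhysics.KineticTheory.TendstoHydroFieldsAt (fun N => Literature.MathematicalPhysics.KineticTheory.localGibbsLaw σ a₀ u₀ θ₀ N (Φ N)) Φ ρ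 u θ 0 → ∀ t ∈ Set.Ico 0 T, ∃ V₀ : ℝ, 0 < V₀ ∧ ∀ V : ℝ, V₀ ≤ V → ∀ ε : ℝ, 0 < ε → ∃ τ₀ : ℝ, 0 < τ₀ ∧ ∀ τ : ℝ, τ₀ ≤ τ → ∃ N₀ : ℕ, ∀ N : ℕ, N₀ ≤ N → ∀ s ∈ Set.Icc 0 t, (let w : ℝ := τ * ((N : ℝ) + 1) ^ (-(1 / 3 : ℝ)); let P := Literature.MathematicalPhysics.KineticTheory.localGibbsLaw σ a₀ u₀ θ₀ N (Φ N); let act := fun (i : Fin (N + 1)) z => σ / τ * (Φ N).collisionSum (Set.Ioc s (s + w)) (fun c => if c.fst = i then |‖c.postVel.1‖ ^ 2 - ‖c.preVel.1‖ ^ 2| / 2 else 0) z; ∫⁻ z, ENNReal.ofReal (((N : ℝ) + 1)⁻¹ * ∑ i : Fin (N + 1), Set.indicator {y : ℝ | V < y} (fun y => y) (act i z)) ∂P ≤ ENNReal.ofReal ε)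

def CollisionActivityTails : Prop :=
  ∀ (a₀ θ₀ : Literature.MathematicalPhysics.KineticTheory.T3 → ℝ) (u₀ : Literature.MathematicalPhysics.KineticTheory.T3 → Literature.MathematicalPhysics.KineticTheory.V3), Continuous a₀ → Continuous θ₀ → Continuous u₀ → (∀ x, 0 < a₀ x) → (∀ x, 0 < θ₀ x) → ∃ σ₀ : ℝ, 0 < σ₀ ∧ ∀ σ : ℝ, 0 < σ → σ < σ₀ → ∀ (T : ℝ) (ρ θ : ℝ → Literature.MathematicalPhysics.KineticTheory.T3 → ℝ) (u : ℝ → Literature.MathematicalPhysics.KineticTheory.T3 → Literature.MathematicalPhysics.KineticTheory.V3), Literature.MathematicalPhysics.KineticTheory.IsHardSphereEulerSolution σ T ρ u θ → ∀ Φ : (N : ℕ) → Literature.Analysis.FluidPDE.HardSphereFlow (Literature.Analysis.FluidPDE.Torus.geometry (Fin 3)) (Literature.MathematicalPhysics.KineticTheory.hsDiameter σ N) (N + 1), Literature.MathematicalPhysics.KineticTheory.TendstoHydroFieldsAt (fun N => Literature.MathematicalPhysics.KineticTheory.localGibbsLaw σ a₀ u₀ θ₀ N (Φ N)) Φ ρ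 u θ 0 → ∀ t ∈ Set.Ico 0 T, ∃ V₀ : ℝ, 0 < V₀ ∧ ∀ V : ℝ, V₀ ≤ V → ∀ ε : ℝ, 0 < ε → ∃ τ₀ : ℝ, 0 < τ₀ ∧ ∀ τ : ℝ, τ₀ ≤ τ → ∃ N₀ : ℕ, ∀ N : ℕ, N₀ ≤ N → ∀ s ∈ Set.Icc 0 t, (let w : ℝ := τ * ((N : ℝ) + 1) ^ (-(1 / 3 : ℝ)); let P := Literature.MathematicalPhysics.KineticTheory.localGibbsLaw σ a₀ u₀ θ₀ N (Φ N); let act := fun (i : Fin (N + 1)) (z : Literature.Analysis.FluidPDE.Config (N + 1) (Fin 3) Literature.MathematicalPhysics.KineticTheory.T3) => σ / τ * (Φ N).collisionSum (Set.Ioc s (s + w)) (fun c => if c.fst = i then ‖c.postVel.1 - c.preVel.1‖ else 0) z; ∫⁻ z, ENNReal.ofReal (((N : ℝ) + 1)⁻¹ * ∑ i : Fin (N + 1), Set.indicator {y : ℝ | V < y} (fun y => y) (act i z)) ∂P ≤ ENNReal.ofReal ε)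

/-- The split glue, by name: the crux from the five children (term = the landed `--glue-by` decl). -/
theorem HydroLimitProfilewiseBand_of_subs :
    SuperExponentialEnergyTails → KineticCurrentsLDAlongFamiliesQ → LocalClampedTransferLDAlongFamilies →
      EnergyActivityTails → CollisionActivityTails →
      Summit.AtomisticToContinuum.HydrodynamicLimit.Theses.ImplosionDichotomy.HydroLimitProfilewiseBand :=
  Summit.AtomisticToContinuum.HydrodynamicLimit.Theorems.HydroLimitProfilewiseBandKcwfQGlue.hydroLimitProfilewiseBand_of_itemInputs

/-- The same glue also closes the sibling stmt-9133 from the same children. -/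
theorem HydroLimitInBand_of_subs :
    SuperExponentialEnergyTails → KineticCurrentsLDAlongFamiliesQ → LocalClampedTransferLDAlongFamilies →
      EnergyActivityTails → CollisionActivityTails →
      Summit.AtomisticToContinuum.HydrodynamicLimit.Theses.ImplosionDichotomy.HydroLimitInBand :=
  Summit.AtomisticToContinuum.HydrodynamicLimit.Theorems.HydroLimitProfilewiseBandKcwfQGlue.hydroLimitInBand_of_itemInputs

/-! Dedup certificates: each child is definitionally the OneFlightGossipEngine item. -/
example : SuperExponentialEnergyTails ↔ OneFlightGossipEngine.SuperExponentialEnergyTails := Iff.rfl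
example : KineticCurrentsLDAlongFamiliesQ ↔ OneFlightGossipEngine.KineticCurrentsLDAlongFamiliesQ := Iff.rfl
example : LocalClampedTransferLDAlongFamilies ↔ OneFlightGossipEngine.LocalClampedTransferLDAlongFamilies := Iff.rfl
example : EnergyActivityTails ↔ OneFlightGossipEngine.EnergyActivityTails := Iff.rfl
example : CollisionActivityTails ↔ OneFlightGossipEngine.CollisionActivityTails := Iff.rfl

#print axioms HydroLimitProfilewiseBand_of_subs

end Summit.AtomisticToContinuum.HydrodynamicLimit.Cruxes.HydroLimitProfilewiseBand.SplitCertificate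

end
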